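import Summits.AtomisticToContinuum.Crystallization.Theorems.ChartedZeroExcessLayeredLatticeLiouvilleZZZYRCXRL
import Mathlib.Algebra.Order.BigOperators.Group.List

/-!
# ChartedZeroExcessLayeredLatticeLiouville · ZZZYRCXRS — THE θ⁰ OUT-OF-WINDOW KERNEL: ONE CHORD AND THE SLAB (§5–§6; ★★ `slabAccO_sound`)
(decomp-a2c hand-1 g55, STAGED with RCXRK/RCXRL for g56; critic r1871 (D))

§5 `walkPO_mono` (the out walk only grows the tables), `chordXO/chordEO` (the chord vector under a letter assignment `ρ`), `octx_of_adm`
(the context `octx` builds at the trial selected by an admissible `ρ` IS `ctxOf ρ …` whenever `ρ`'s chord length is in the window),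
`addChordO_eq`, ★★ `addChordO_sound`; §6 `inRangeO`/`chordRO`/`chordNO` (the per-chord contributions under `ρ`, zero off the window),
`chordFoldO_sound`, ★★ `slabAccO_sound`: `slabAccO … = some T` ⇒ for EVERY admissible `ρ` (window letters fixed, the others arbitrary in
`{0,1,2}`) every in-range chord has valid pieces under `ρ` and the table dominates key-wise the summed dyadic coefficients `Σ_c chordRO/chordNO`
— the θ_out analogue of RCXL's `slabAcc_sound`.  Imports RCXRL; 0 sorry.  All `[folklore]`.
-/

namespace Summit.AtomisticToContinuum.Crystallization.Theorems.ChartedZeroExcessLayeredLatticeLiouville.ThetaKernel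

/-! ## §5 one out-chord -/

/-- the out walk only ADDS to the tables (for trial letters other than `ρ`'s the coefficients are booked too — harmless upper bounds). [folklore] -/
theorem walkPO_mono (win : List ℕ) (wlo whi amY P9 An : ℕ) (ctxs : List OCtx) :
    ∀ (cs : List ℕ) (a0 a1 am : ℕ) (t t' : PT), walkPO win wlo whi amY P9 An ctxs a0 a1 am cs t = some t' →
    ∀ q, tabR t.toList q ≤ tabR t'.toList q ∧ tabN t.toList q ≤ tabN t'.toList q
  | [], a0, a1, am, t, t', h, q => by
    rw [walkPO_nil, Option.some.injEq] at h
    subst h; exact ⟨le_rfl, le_rfl⟩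
  | c :: rest, a0, a1, am, t, t', h, q => by
    rw [walkPO_cons] at h
    cases hpc : pieceO win wlo whi amY P9 An ctxs a0 a1 am c with
    | none => rw [hpc] at h; exact absurd h (by simp)
    | some cN =>
      rw [hpc] at h
      simp only at h
      cases hb : t.bump (keyO a0 a1 am (c / 1442401) (c / 1201 % 1201) (c % 1201)) (cRmax ctxs) cN with
      | none => rw [hb] at h; exact absurd h (by simp)
      | some t₁ =>
        rw [hb] at h
        simp only at h
        obtain ⟨ih1, ih2⟩ := walkPO_mono win wlo whi amY P9 An ctxs rest _ _ _ t₁ t' h q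
        have h1 := tabR_bump hb q
        have h2 := tabN_bump hb q
        constructor
        · have : tabR t.toList q ≤ tabR t₁.toList q := by rw [h1]; split_ifs <;> omega
          exact this.trans ih1
        · have : tabN t.toList q ≤ tabN t₁.toList q := by rw [h2]; split_ifs <;> omega
          exact this.trans ih2

/-- the shifted base site of the window centre. -/
def chordXO (amX : ℕ) : ℕ × ℕ × ℕ := (600, 600, amX)

/-- the chord vector `e = Y − X` under the letter assignment `ρ`. -/
def chordEO (ρ : ℕ → ℕ) (amX : ℕ) (c : List ℕ) : ℤ × ℤ × ℤ := vecL ρ (chordXO amX, dec3 (lastD c 0))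

/-- `octx` at the trial selected by an admissible `ρ` IS `ctxOf ρ …` with the chord vector under `ρ`, provided that vector's `u9` is in the
window; the base layer must lie in the letter window. [folklore] -/
theorem octx_of_adm {win : List ℕ} {wlo whi amX : ℕ} {ρ : ℕ → ℕ} (hρ : AdmO win wlo whi ρ) (hX : inWin wlo whi amX = true)
    (AE n y0 y1 ym : ℕ) {lo hi : ℤ}
    (hlo : lo < n9Z (vecL ρ (chordXO amX, (y0, y1, ym)))) (hhi : n9Z (vecL ρ (chordXO amX, (y0, y1, ym))) ≤ hi) :
    let e := vecL ρ (chordXO amX, (y0, y1, ym))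
    let u9n := (n9Z e).toNat
    octx win wlo whi amX AE n y0 y1 ym lo hi (bif inWin wlo whi ym then 0 else ρ ym) =
      some (ctxOf ρ ym (2 * e.1 + e.2.1) (2 * e.2.1 + e.1) (12 * e.2.2) (4 * (u9n * u9n * (u9n * u9n)) * u9n) (4 * u9n)
        ((AE * n + u9n * u9n * (u9n * u9n) - 1) / (u9n * u9n * (u9n * u9n)))) := by
  intro e u9n
  have hrX : regO win wlo whi ym (bif inWin wlo whi ym then 0 else ρ ym) ym (bif inWin wlo whi ym then 0 else ρ ym)
      (bif inWin wlo whi ym then 0 else ρ ym) amX = ρ amX := by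
    unfold regO; rw [hX]; simp only [cond_true]; exact (hρ.1 amX hX).symm
  have hrY : regO win wlo whi ym (bif inWin wlo whi ym then 0 else ρ ym) ym (bif inWin wlo whi ym then 0 else ρ ym)
      (bif inWin wlo whi ym then 0 else ρ ym) ym = ρ ym := by
    unfold regO
    cases hw : inWin wlo whi ym
    · simp only [cond_false, Nat.beq_refl, cond_true]
    · simp only [cond_true]; exact (hρ.1 ym hw).symm
  have he : e = (3 * ((y0 : ℤ) - 600) + ((ρ ym : ℤ) - ρ amX), 3 * ((y1 : ℤ) - 600) + ((ρ ym : ℤ) - ρ amX), (ym : ℤ) - amX) := rfl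
  have hu9 : (3 * ((y0 : ℤ) - 600) + ((ρ ym : ℤ) - ρ amX)) * (3 * ((y0 : ℤ) - 600) + ((ρ ym : ℤ) - ρ amX)) +
      (3 * ((y0 : ℤ) - 600) + ((ρ ym : ℤ) - ρ amX)) * (3 * ((y1 : ℤ) - 600) + ((ρ ym : ℤ) - ρ amX)) +
      (3 * ((y1 : ℤ) - 600) + ((ρ ym : ℤ) - ρ amX)) * (3 * ((y1 : ℤ) - 600) + ((ρ ym : ℤ) - ρ amX)) +
      6 * ((ym : ℤ) - amX) * ((ym : ℤ) - amX) = n9Z e := by rw [he]; simp only [n9Z]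
  unfold octx
  rw [hrX, hrY]
  simp only
  rw [hu9]
  have hg : ((n9Z e ≤ lo : Bool) || (hi < n9Z e : Bool)) = false := by
    rw [Bool.or_eq_false_iff, decide_eq_false_iff_not, decide_eq_false_iff_not]; exact ⟨not_le.mpr hlo, not_lt.mpr hhi⟩
  rw [hg]
  simp only [cond_false, ctxOf, he]
  rfl


/-- unfolding `addChordO` (lets inlined). [folklore] -/
theorem addChordO_eq (win : List ℕ) (wlo whi amX P9 AE : ℕ) (lo hi : ℤ) (c : List ℕ) (t : PT) :
    addChordO win wlo whi amX P9 AE lo hi c t =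
      (let ctxs := (trials (!(inWin wlo whi (lastD c 0 % 1201)))).filterMap
        (octx win wlo whi amX AE c.length (lastD c 0 / 1442401) (lastD c 0 / 1201 % 1201) (lastD c 0 % 1201) lo hi)
      bif ctxs.isEmpty then none else walkPO win wlo whi (lastD c 0 % 1201) P9 (AE * c.length) ctxs 600 600 amX c t) := rfl

/-- ★ ONE OUT-CHORD IS SOUND.  A successful `addChordO` (base layer in the letter window, shifted base `< 1201`) only grows the tables, and for
every admissible `ρ` whose chord vector `e = chordEO ρ amX c` has `lo < n9 ≤ hi`: every piece is valid UNDER `ρ`, the R sums grow by at least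
`coefRn (AE·n) u9` per piece and the N sums by at least `coefNn (AE·n) (4u9⁵) (4u9) p9 |d18Z e v|` per piece (key-wise). [folklore] -/
theorem addChordO_sound {win : List ℕ} {wlo whi amX P9 AE : ℕ} {lo hi : ℤ} {ρ : ℕ → ℕ} (hρ : AdmO win wlo whi ρ)
    (hX : inWin wlo whi amX = true) (hmX : amX < 1201) {c : List ℕ} {t t' : PT}
    (h : addChordO win wlo whi amX P9 AE lo hi c t = some t') :
    (∀ q, tabR t.toList q ≤ tabR t'.toList q ∧ tabN t.toList q ≤ tabN t'.toList q) ∧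
    (lo < n9Z (chordEO ρ amX c) → n9Z (chordEO ρ amX c) ≤ hi →
      (∀ pr ∈ piecesFrom (chordXO amX) c,
          pr.2.1 < 1201 ∧ pr.2.2.1 < 1201 ∧ pr.2.2.2 < 1201 ∧ 0 < n9Z (vecL ρ pr) ∧ n9Z (vecL ρ pr) ≤ P9) ∧
      (∀ q, tabR t.toList q + (((piecesFrom (chordXO amX) c).filter fun pr => keyOf pr = q).map fun _ =>
          coefRn (AE * c.length) (n9Z (chordEO ρ amX c)).toNat).sum ≤ tabR t'.toList q) ∧
      (∀ q, tabN t.toList q + (((piecesFrom (chordXO amX) c).filter fun pr => keyOf pr = q).map fun pr =>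
          coefNn (AE * c.length)
            (4 * ((n9Z (chordEO ρ amX c)).toNat * (n9Z (chordEO ρ amX c)).toNat *
              ((n9Z (chordEO ρ amX c)).toNat * (n9Z (chordEO ρ amX c)).toNat)) * (n9Z (chordEO ρ amX c)).toNat)
            (4 * (n9Z (chordEO ρ amX c)).toNat) (n9Z (vecL ρ pr)).toNat (d18Z (chordEO ρ amX c) (vecL ρ pr)).natAbs).sum ≤
        tabN t'.toList q)) := by
  rw [addChordO_eq] at h
  extract_lets ctxs at h
  cases he : ctxs.isEmpty with
  | true => rw [he] at h; exact absurd h (by simp)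
  | false =>
    rw [he] at h
    simp only [cond_false] at h
    refine ⟨walkPO_mono win wlo whi _ P9 _ ctxs c 600 600 amX t t' h, fun hlo hhi => ?_⟩
    -- the context of `ρ` is listed (`chordEO ρ amX c` is `vecL ρ (chordXO amX, dec3 (lastD c 0))` by `rfl`)
    have hκ : ctxOf ρ (lastD c 0 % 1201) (2 * (chordEO ρ amX c).1 + (chordEO ρ amX c).2.1)
        (2 * (chordEO ρ amX c).2.1 + (chordEO ρ amX c).1) (12 * (chordEO ρ amX c).2.2)
        (4 * ((n9Z (chordEO ρ amX c)).toNat * (n9Z (chordEO ρ amX c)).toNat *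
          ((n9Z (chordEO ρ amX c)).toNat * (n9Z (chordEO ρ amX c)).toNat)) * (n9Z (chordEO ρ amX c)).toNat)
        (4 * (n9Z (chordEO ρ amX c)).toNat)
        ((AE * c.length + (n9Z (chordEO ρ amX c)).toNat * (n9Z (chordEO ρ amX c)).toNat *
          ((n9Z (chordEO ρ amX c)).toNat * (n9Z (chordEO ρ amX c)).toNat) - 1) /
          ((n9Z (chordEO ρ amX c)).toNat * (n9Z (chordEO ρ amX c)).toNat *
            ((n9Z (chordEO ρ amX c)).toNat * (n9Z (chordEO ρ amX c)).toNat))) ∈ ctxs := by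
      refine List.mem_filterMap.mpr ⟨bif inWin wlo whi (lastD c 0 % 1201) then 0 else ρ (lastD c 0 % 1201), ?_, ?_⟩
      · unfold trials
        cases inWin wlo whi (lastD c 0 % 1201)
        · have := hρ.2 (lastD c 0 % 1201)
          simp only [Bool.not_false, cond_true, cond_false, List.mem_cons, List.not_mem_nil, or_false]
          omega
        · simp
      · exact octx_of_adm hρ hX AE c.length (lastD c 0 / 1442401) (lastD c 0 / 1201 % 1201) (lastD c 0 % 1201) hlo hhi
    obtain ⟨W1, W2, W3⟩ := walkPO_sound win wlo whi (lastD c 0 % 1201) P9 (AE * c.length) ctxs hρ hκ c 600 600 amX t t'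
      (by norm_num) (by norm_num) hmX h
    have hcR := cR_le_cRmax hκ
    refine ⟨W1, fun q => ?_, fun q => ?_⟩
    · rw [W2 q]
      apply Nat.add_le_add_left
      refine List.sum_le_sum fun pr _ => ?_
      exact hcR
    · have h3 := W3 q
      exact le_of_eq_of_le (by rfl) h3


/-! ## §6 the out-slab fold -/

/-- is the chord's ideal length under `ρ` in the window? (decidable) -/
def inRangeO (ρ : ℕ → ℕ) (amX : ℕ) (lo hi : ℤ) (c : List ℕ) : Prop := lo < n9Z (chordEO ρ amX c) ∧ n9Z (chordEO ρ amX c) ≤ hi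

/-- `inRangeO` is decidable (two integer comparisons); used by the `if`s of `chordRO` / `chordNO`. -/
instance (ρ : ℕ → ℕ) (amX : ℕ) (lo hi : ℤ) (c : List ℕ) : Decidable (inRangeO ρ amX lo hi c) := by unfold inRangeO; infer_instance

/-- the R contribution of one out-chord under `ρ` at key `q` (zero if `ρ`'s chord is off the window). -/
def chordRO (ρ : ℕ → ℕ) (AE amX : ℕ) (lo hi : ℤ) (c : List ℕ) (q : ℕ) : ℕ :=
  if inRangeO ρ amX lo hi c then
    (((piecesFrom (chordXO amX) c).filter fun pr => keyOf pr = q).map fun _ => coefRn (AE * c.length) (n9Z (chordEO ρ amX c)).toNat).sum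
  else 0

/-- the N contribution of one out-chord under `ρ` at key `q` (zero if off the window). -/
def chordNO (ρ : ℕ → ℕ) (AE amX : ℕ) (lo hi : ℤ) (c : List ℕ) (q : ℕ) : ℕ :=
  if inRangeO ρ amX lo hi c then
    (((piecesFrom (chordXO amX) c).filter fun pr => keyOf pr = q).map fun pr =>
      coefNn (AE * c.length)
        (4 * ((n9Z (chordEO ρ amX c)).toNat * (n9Z (chordEO ρ amX c)).toNat *
          ((n9Z (chordEO ρ amX c)).toNat * (n9Z (chordEO ρ amX c)).toNat)) * (n9Z (chordEO ρ amX c)).toNat)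
        (4 * (n9Z (chordEO ρ amX c)).toNat) (n9Z (vecL ρ pr)).toNat (d18Z (chordEO ρ amX c) (vecL ρ pr)).natAbs).sum
  else 0

/-- ★ THE OUT-CHORD FOLD: a successful fold certifies, for every admissible `ρ`, every IN-RANGE chord's pieces and dominates key-wise the summed
contributions `chordRO/chordNO` (off-range chords contribute zero; the tables only grow). [folklore] -/
theorem chordFoldO_sound {win : List ℕ} {wlo whi amX P9 AE : ℕ} {lo hi : ℤ} {ρ : ℕ → ℕ} (hρ : AdmO win wlo whi ρ)
    (hX : inWin wlo whi amX = true) (hmX : amX < 1201) :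
    ∀ (cs : List (List ℕ)) (t t' : PT),
    cs.foldl (fun acc c => match acc with | none => none | some t => addChordO win wlo whi amX P9 AE lo hi c t) (some t) = some t' →
    (∀ c ∈ cs, inRangeO ρ amX lo hi c → ∀ pr ∈ piecesFrom (chordXO amX) c,
        pr.2.1 < 1201 ∧ pr.2.2.1 < 1201 ∧ pr.2.2.2 < 1201 ∧ 0 < n9Z (vecL ρ pr) ∧ n9Z (vecL ρ pr) ≤ P9) ∧
    (∀ q, tabR t.toList q + (cs.map fun c => chordRO ρ AE amX lo hi c q).sum ≤ tabR t'.toList q) ∧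
    (∀ q, tabN t.toList q + (cs.map fun c => chordNO ρ AE amX lo hi c q).sum ≤ tabN t'.toList q)
  | [], t, t', h => by
    simp only [List.foldl_nil, Option.some.injEq] at h
    subst h; simp
  | c :: rest, t, t', h => by
    simp only [List.foldl_cons] at h
    have hnone : ∀ l : List (List ℕ),
        l.foldl (fun acc c => match acc with | none => none | some t => addChordO win wlo whi amX P9 AE lo hi c t) none = none :=
      fun l => by
        induction l with
        | nil => rfl
        | cons _ _ ih => exact ih
    cases hc : addChordO win wlo whi amX P9 AE lo hi c t with
    | none => rw [hc, hnone] at h; exact absurd h (by simp)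
    | some t₁ =>
      rw [hc] at h
      obtain ⟨hmono, hin⟩ := addChordO_sound (P9 := P9) (AE := AE) (lo := lo) (hi := hi) hρ hX hmX hc
      obtain ⟨IH1, IH2, IH3⟩ := chordFoldO_sound hρ hX hmX rest t₁ t' h
      refine ⟨fun d hd hr => ?_, fun q => ?_, fun q => ?_⟩
      · rcases List.mem_cons.mp hd with rfl | hd
        · exact (hin hr.1 hr.2).1
        · exact IH1 d hd hr
      · have ih := IH2 q
        by_cases hr : inRangeO ρ amX lo hi c
        · have h1 := (hin hr.1 hr.2).2.1 q
          have hhead : chordRO ρ AE amX lo hi c q = (((piecesFrom (chordXO amX) c).filter fun pr => keyOf pr = q).map fun _ =>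
              coefRn (AE * c.length) (n9Z (chordEO ρ amX c)).toNat).sum := by simp only [chordRO, if_pos hr]
          rw [List.map_cons, List.sum_cons, hhead]
          omega
        · have hhead : chordRO ρ AE amX lo hi c q = 0 := by simp only [chordRO, if_neg hr]
          rw [List.map_cons, List.sum_cons, hhead]
          have h1 := (hmono q).1
          omega
      · have ih := IH3 q
        by_cases hr : inRangeO ρ amX lo hi c
        · have h1 := (hin hr.1 hr.2).2.2 q
          have hhead : chordNO ρ AE amX lo hi c q = (((piecesFrom (chordXO amX) c).filter fun pr => keyOf pr = q).map fun pr =>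
              coefNn (AE * c.length)
                (4 * ((n9Z (chordEO ρ amX c)).toNat * (n9Z (chordEO ρ amX c)).toNat *
                  ((n9Z (chordEO ρ amX c)).toNat * (n9Z (chordEO ρ amX c)).toNat)) * (n9Z (chordEO ρ amX c)).toNat)
                (4 * (n9Z (chordEO ρ amX c)).toNat) (n9Z (vecL ρ pr)).toNat (d18Z (chordEO ρ amX c) (vecL ρ pr)).natAbs).sum := by
            simp only [chordNO, if_pos hr]
          rw [List.map_cons, List.sum_cons, hhead]
          omega
        · have hhead : chordNO ρ AE amX lo hi c q = 0 := by simp only [chordNO, if_neg hr]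
          rw [List.map_cons, List.sum_cons, hhead]
          have h1 := (hmono q).2
          omega

/-- ★★ THE OUT-SLAB PROGRAM IS SOUND (kernel side): `slabAccO win wlo whi amX P9 E lo hi t0 cs = some T` ⇒ for EVERY admissible letter
assignment `ρ`, every chord whose ideal length under `ρ` lies in `(lo, hi]` has valid pieces under `ρ`, and key-wise the table DOMINATES the
summed dyadic coefficients of those chords' incidences (the θ_out analogue of RCXL's `slabAcc_sound`; letters outside the window are
arbitrary — the aperiodic registries). [folklore] -/
theorem slabAccO_sound {win : List ℕ} {wlo whi amX P9 E : ℕ} {lo hi : ℤ} {ρ : ℕ → ℕ} (hρ : AdmO win wlo whi ρ)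
    (hX : inWin wlo whi amX = true) (hmX : amX < 1201) (t0 : PT) (cs : List (List ℕ)) (T : List (ℕ × ℕ × ℕ))
    (h : slabAccO win wlo whi amX P9 E lo hi t0 cs = some T) :
    (∀ c ∈ cs, inRangeO ρ amX lo hi c → ∀ pr ∈ piecesFrom (chordXO amX) c,
        pr.2.1 < 1201 ∧ pr.2.2.1 < 1201 ∧ pr.2.2.2 < 1201 ∧ 0 < n9Z (vecL ρ pr) ∧ n9Z (vecL ρ pr) ≤ P9) ∧
    (∀ q, (cs.map fun c => chordRO ρ (2 ^ E * 45927) amX lo hi c q).sum ≤ tabR T q) ∧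
    (∀ q, (cs.map fun c => chordNO ρ (2 ^ E * 45927) amX lo hi c q).sum ≤ tabN T q) := by
  unfold slabAccO at h
  simp only [Option.map_eq_some_iff] at h
  obtain ⟨t', ht', hT⟩ := h
  obtain ⟨H1, H2, H3⟩ := chordFoldO_sound (P9 := P9) (AE := 2 ^ E * 45927) (lo := lo) (hi := hi) hρ hX hmX cs t0 t' ht'
  refine ⟨H1, fun q => ?_, fun q => ?_⟩
  · rw [← hT]; have := H2 q; omega
  · rw [← hT]; have := H3 q; omega

end Summit.AtomisticToContinuum.Crystallization.Theorems.ChartedZeroExcessLayeredLatticeLiouville.ThetaKernel
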